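import Mathlib

/-!
# `Balaban1983to89.B4Eq212SupNeumann` — [Balaban1983RegularityDecay] (2.9)–(2.12) pp. 576–577 IN THE SUP NORM, ABSTRACT FORM:
# the parametrix `G₀ = Σ_j h_jG_k(□_j,Ã_j)h_j` (2.2), the identity `(−Δ + m² + aP)G₀ = I − R` (2.9)–(2.11) and
# «R is a small operator in reasonable norms … so we have the representations G_k(Ω,A) = G₀(I − R)⁻¹» (2.12)
# ⇒ the `L^∞` OPERATOR-NORM BOUND `‖G_k(Ω,A)‖_{∞→∞} ≤ 2m₀γ` from the two per-cube inputs, on ANY finite family of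
# «cubes» acting on one space of `E`-valued lattice functions — no geometry (torus, box or region alike)

statement-level skeleton of published theorems with citation tags; proofs where landed; nothing here is a claim about the Yang–Mills mass gap

CITATION HEADER (lean-in-tree rule).  T. Bałaban, *Regularity and decay of lattice Green's functions*, Commun. Math.
Phys. **89** (1983) 571–597, doi:10.1007/bf01214744 [Balaban1983RegularityDecay] (cell paper B4; held text
`paper:balaban1983-cmp89-regularity-decay`, journal page = PDF page + 570; pp. 575–577 read by this seat).  Cell
`lit-balaban` (HOME `run/shared/lean/pub/lit-balaban/`), Phase-2 proof seat **p35** gen 8 (unit `lit-balaban-p35`);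
SKELETON rows **B4.Eq2.2**, **B4.Eq2.10**, **B4.Eq2.12**, **B4.Thm@573** ((1.10) value member), and — the consumer this
file is written for — **B1.Prop2.1**/(2.25) + **B1.Thm@606** (the scalar half `hGs` of the (E3)/(3.67) input of
`B1LowerBound114Model.Inputs`, p14's `B1Ineq367SmallFieldTorus`): the TORUS `Ω = T_ε`, where every cube `□_j` is an
interior cube, is the case the region-carrier walk routes of the tree (`B4Ineq110WalkRoute`, positions in `ℝ^d`) do not
cover; this file is the geometry-free core that the torus files of this seat (`B1TorusCubeCover`,
`B1TorusCubeLocality26`, …) instantiate.  RELATION TO THE TREE (nothing restated): r01's `B4Ineq110WalkRoute.ineq110_value`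
is the same mechanism for MATRICES over region carriers with the full walk (2.13) and its decay; here only the
`n = 0` consequence of (2.12) — the operator-norm bound — is proved, for LINEAR MAPS on a Pi normed space, which is
what the Higgs-model carriers (`HiggsLattice.ScalarField P 0 N = Site P 0 → ℝ^N`, sup norm) are.

WHAT IS PRINTED (pp. 575–577; OCR-checked against the held text).  p. 575: *«Next let us define a partition of unity
{h_j}_{j∈Z^d} on T_η. … it is chosen in such a way that Σ_{j∈Z} h_j² = 1. Let us define an operator G₀ by the formula
G₀ = Σ_j h_jG_k(□_j, Ã_j)h_j (2.2) … if □_j is an interior cube of Ω, then we take Ã_j as equal to A on the cube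
{x : |x − Mj| ≤ ¾M} … We will prove that G₀ is a very good approximation of the operator G_k(Ω, A).»*  p. 576:
(2.6) *«(−Δ^{η,N}_{A,Ω})h_jG(□_j, Ã_j) = (−Δ^{η,N}_{Ã_j,□_j})h_jG(□_j, Ã_j), because the function h_j can be ≠ 0 only on
the part of the boundary of □_j which is contained in the boundary of Ω»*; (2.9) *«(−Δ + m² + aP)G₀ = δ − Σ_j[…]»*,
(2.10)–(2.11) *«K_j = … , R = Σ_j K_jG_k(□_j,Ã_j)h_j»*.  p. 577: *«In the sequel we will see that R is a small operator
in reasonable norms because |∂^ηh_j| ≤ O(M⁻¹), |Δ^ηh_j| ≤ O(M⁻²), so we have the representations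
G_k(Ω, A) = G₀(I − R)⁻¹ = Σ_{n=0}^∞ G₀Rⁿ. (2.12)»*.

WHAT THIS FILE PROVES (theorems only, kernel-checked; no `def`, no `sorry`; axioms standard).  On `X → E` (`X` a finite
index set, `E` a real normed space; sup norm), for a linear operator `H` with a left inverse `G` (`GH = 1`), a finite
family of «cube operators» `H_j` with right inverses `G_j` (`H_jG_j = 1`), real bumps `h_j` with `Σ_j h_j(x)² = 1` and
`|h_j| ≤ 1`, and the AGREEMENT (2.6) `H(h_jψ) = H_j(h_jψ)`:
* `parametrix_identity` — (2.9)–(2.11): `H(Σ_j h_jG_j(h_jφ)) = φ + Σ_j K_j(G_j(h_jφ))`, `K_jθ := H_j(h_jθ) − h_jH_jθ`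
  (the commutator `[H_j, h_j]` of (2.10); `R = −Σ_jK_jG_jh_j`);
* `norm_parametrix_le` — `‖G₀φ‖ ≤ m₀γ‖φ‖` from the per-cube sup bound `‖G_j(h_jψ)‖ ≤ γ‖ψ‖` (Lemma 2.2 (2.17),
  `p = q = ∞`) and the row multiplicity `m₀` of the supports `S_j ⊇ supp h_j` (`2^d` for the printed cubes);
* `norm_remainder_le` — `‖Σ_jK_jG_j(h_jφ)‖ ≤ m₀β‖φ‖` from the (2.20)-type factor bound `‖K_jG_j(h_jψ)‖ ≤ β‖ψ‖` and the
  same multiplicity (`K_j` has its rows in `S_j`);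
* **`norm_inverse_apply_le`** — (2.12): if `m₀β ≤ ½` then `‖Gφ‖ ≤ 2m₀γ‖φ‖` for every `φ` (`G = G₀ − GR·`, and the
  operator norm of `G`, finite since `dim E < ∞`, absorbs `‖R‖ ≤ ½`); `norm_inverse_apply_le_of_isUnit` — the same
  for `Ring.inverse H` when `H` is a unit (the shape of `HiggsCovariance.propagatorK`).
HONEST SCOPE.  Only the `n = 0` consequence of (2.12) (the operator-norm bound), not the walk (2.13) or any decay;
the per-cube inputs `γ`, `β`, the agreement (2.6) and the multiplicity are HYPOTHESES here (discharged on the torus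
by this seat's `B1TorusCube*` files); `E` finite-dimensional for the last two theorems.  Unit `lit-balaban-p35` gen 8
(literature-prover-lit-balaban-p35-g8-0).
-/

open scoped BigOperators

namespace Literature.MathematicalPhysics.QuantumFieldTheory.Balaban1983to89.B4Eq212SupNeumann

variable {X : Type*} [Fintype X] [DecidableEq X] {E : Type*} [NormedAddCommGroup E] [NormedSpace ℝ E]
variable {J : Type*} [Fintype J]

/-! ## §1 The parametrix identity (2.9)–(2.11) -/

omit [Fintype X] [DecidableEq X] in
/-- **(2.9)–(2.11), operator form.**  With `G₀φ = Σ_j h_j·G_j(h_jφ)` (2.2) and `K_jθ = H_j(h_jθ) − h_j·H_jθ` (the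
commutator (2.10)), the agreement (2.6) `H(h_jψ) = H_j(h_jψ)`, `H_jG_j = 1` and `Σ_j h_j² = 1` give
`H(G₀φ) = φ + Σ_j K_j(G_j(h_jφ))`, i.e. `(−Δ + m² + aP)G₀ = I − R` with `R = −Σ_jK_jG_jh_j` (2.11).
[cite: Balaban1983RegularityDecay, (2.9)–(2.11) p.576] -/
theorem parametrix_identity (H : Module.End ℝ (X → E)) (Hj Gj : J → Module.End ℝ (X → E))
    (hHG : ∀ j, Hj j * Gj j = 1) (h : J → X → ℝ) (hsum : ∀ x, ∑ j, h j x ^ 2 = 1)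
    (hagree : ∀ j (ψ : X → E), H (h j • ψ) = Hj j (h j • ψ)) (φ : X → E) :
    H (∑ j, h j • Gj j (h j • φ))
      = φ + ∑ j, (Hj j (h j • Gj j (h j • φ)) - h j • Hj j (Gj j (h j • φ))) := by
  rw [map_sum]
  have hterm : ∀ j, H (h j • Gj j (h j • φ))
      = h j • (h j • φ) + (Hj j (h j • Gj j (h j • φ)) - h j • Hj j (Gj j (h j • φ))) := by
    intro j
    rw [hagree]
    have hid : Hj j (Gj j (h j • φ)) = h j • φ := by
      rw [← Module.End.mul_apply, hHG, Module.End.one_apply]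
    rw [hid]
    abel
  simp_rw [hterm]
  rw [Finset.sum_add_distrib]
  congr 1
  funext x
  rw [Finset.sum_apply]
  simp only [Pi.smul_apply', smul_smul]
  rw [← Finset.sum_smul]
  have h1 : ∑ j, h j x * h j x = 1 := by simpa [sq] using hsum x
  rw [h1, one_smul]

/-! ## §2 The two norm bounds: `‖G₀‖ ≤ m₀γ`, `‖R‖ ≤ m₀β` -/

/-- **`‖G₀φ‖_∞ ≤ m₀γ‖φ‖_∞`**: at each site at most `m₀` bumps are non-zero (`supp h_j ⊆ S_j`, multiplicity of the
`S_j`), `|h_j| ≤ 1`, and each cube propagator obeys the sup bound `‖G_j(h_jψ)‖ ≤ γ‖ψ‖` (Lemma 2.2 (2.17) at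
`p = q = ∞`). [cite: Balaban1983RegularityDecay, (2.2) p.575; (2.12) p.577] -/
theorem norm_parametrix_le (Gj : J → Module.End ℝ (X → E)) (h : J → X → ℝ) (habs : ∀ j x, |h j x| ≤ 1)
    (S : J → Finset X) (hhS : ∀ j x, h j x ≠ 0 → x ∈ S j)
    (m₀ : ℕ) (hmult : ∀ x, (Finset.univ.filter fun j => x ∈ S j).card ≤ m₀)
    {γ : ℝ} (hγ : 0 ≤ γ) (hGj : ∀ j (ψ : X → E), ‖Gj j (h j • ψ)‖ ≤ γ * ‖ψ‖) (φ : X → E) :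
    ‖∑ j, h j • Gj j (h j • φ)‖ ≤ m₀ * γ * ‖φ‖ := by
  refine (pi_norm_le_iff_of_nonneg (by positivity)).2 fun x => ?_
  rw [Finset.sum_apply]
  have hvanish : ∀ j ∈ (Finset.univ : Finset J), j ∉ Finset.univ.filter (fun j => x ∈ S j) →
      (h j • Gj j (h j • φ)) x = 0 := by
    intro j _ hj
    have hx : x ∉ S j := by simpa using hj
    have h0 : h j x = 0 := by
      by_contra hne
      exact hx (hhS j x hne)
    rw [Pi.smul_apply', h0, zero_smul]
  rw [← Finset.sum_subset (Finset.filter_subset _ _) hvanish]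
  calc ‖∑ j ∈ Finset.univ.filter (fun j => x ∈ S j), (h j • Gj j (h j • φ)) x‖
      ≤ ∑ j ∈ Finset.univ.filter (fun j => x ∈ S j), ‖(h j • Gj j (h j • φ)) x‖ := norm_sum_le _ _
    _ ≤ ∑ j ∈ Finset.univ.filter (fun j => x ∈ S j), γ * ‖φ‖ := by
        refine Finset.sum_le_sum fun j _ => ?_
        rw [Pi.smul_apply', norm_smul]
        calc ‖h j x‖ * ‖(Gj j (h j • φ)) x‖ ≤ 1 * (γ * ‖φ‖) :=
              mul_le_mul (by rw [Real.norm_eq_abs]; exact habs j x)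
                ((norm_le_pi_norm _ x).trans (hGj j φ)) (norm_nonneg _) zero_le_one
          _ = γ * ‖φ‖ := one_mul _
    _ = ((Finset.univ.filter fun j => x ∈ S j).card : ℝ) * (γ * ‖φ‖) := by
        rw [Finset.sum_const, nsmul_eq_mul]
    _ ≤ (m₀ : ℝ) * (γ * ‖φ‖) :=
        mul_le_mul_of_nonneg_right (by exact_mod_cast hmult x) (by positivity)
    _ = m₀ * γ * ‖φ‖ := by ring

/-- **`‖Rφ‖_∞ ≤ m₀β‖φ‖_∞`** for `Rφ = −Σ_jK_jG_j(h_jφ)` (stated for the sum without the sign): the rows of the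
commutator `K_j = [H_j, h_j]` (2.10) live in `S_j` («K_j … □_j(x)[…]», the factor `□_j(x)` and `∂h_j`, `Δh_j`
supported near `supp h_j`), at most `m₀` of the `S_j` meet a site, and each letter obeys the factor bound
`‖K_jG_j(h_jψ)‖ ≤ β‖ψ‖` ((2.20) p. 578). [cite: Balaban1983RegularityDecay, (2.10)–(2.11) p.576; (2.20) p.578] -/
theorem norm_remainder_le (Hj Gj : J → Module.End ℝ (X → E)) (h : J → X → ℝ)
    (S : J → Finset X) (hKS : ∀ j (θ : X → E) x, x ∉ S j → (Hj j (h j • θ) - h j • Hj j θ) x = 0)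
    (m₀ : ℕ) (hmult : ∀ x, (Finset.univ.filter fun j => x ∈ S j).card ≤ m₀)
    {β : ℝ} (hβ : 0 ≤ β)
    (hKj : ∀ j (ψ : X → E), ‖Hj j (h j • Gj j (h j • ψ)) - h j • Hj j (Gj j (h j • ψ))‖ ≤ β * ‖ψ‖)
    (φ : X → E) :
    ‖∑ j, (Hj j (h j • Gj j (h j • φ)) - h j • Hj j (Gj j (h j • φ)))‖ ≤ m₀ * β * ‖φ‖ := by
  refine (pi_norm_le_iff_of_nonneg (by positivity)).2 fun x => ?_
  rw [Finset.sum_apply]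
  have hvanish : ∀ j ∈ (Finset.univ : Finset J), j ∉ Finset.univ.filter (fun j => x ∈ S j) →
      (Hj j (h j • Gj j (h j • φ)) - h j • Hj j (Gj j (h j • φ))) x = 0 := by
    intro j _ hj
    have hx : x ∉ S j := by simpa using hj
    exact hKS j _ x hx
  rw [← Finset.sum_subset (Finset.filter_subset _ _) hvanish]
  calc ‖∑ j ∈ Finset.univ.filter (fun j => x ∈ S j), (Hj j (h j • Gj j (h j • φ)) - h j • Hj j (Gj j (h j • φ))) x‖
      ≤ ∑ j ∈ Finset.univ.filter (fun j => x ∈ S j),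
          ‖(Hj j (h j • Gj j (h j • φ)) - h j • Hj j (Gj j (h j • φ))) x‖ := norm_sum_le _ _
    _ ≤ ∑ j ∈ Finset.univ.filter (fun j => x ∈ S j), β * ‖φ‖ :=
        Finset.sum_le_sum fun j _ => (norm_le_pi_norm _ x).trans (hKj j φ)
    _ = ((Finset.univ.filter fun j => x ∈ S j).card : ℝ) * (β * ‖φ‖) := by
        rw [Finset.sum_const, nsmul_eq_mul]
    _ ≤ (m₀ : ℝ) * (β * ‖φ‖) :=
        mul_le_mul_of_nonneg_right (by exact_mod_cast hmult x) (by positivity)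
    _ = m₀ * β * ‖φ‖ := by ring

/-! ## §3 (2.12): the operator-norm bound of `G = G₀(I − R)⁻¹` -/

/-- **(2.12) IN THE SUP NORM: `‖G_k(Ω,A)φ‖_∞ ≤ 2m₀γ‖φ‖_∞`.**  From (2.9)–(2.11) `HG₀ = 1 − R`, a left inverse `G` of `H`
satisfies `G = G₀ + GR`; with `‖G₀‖ ≤ m₀γ`, `‖R‖ ≤ m₀β ≤ ½` the operator norm of `G` (finite: `E` is finite
dimensional) obeys `‖G‖ ≤ m₀γ + ½‖G‖`, i.e. `‖G‖ ≤ 2m₀γ` — the `L^∞ → L^∞` size of «G_k(Ω, A) = G₀(I − R)⁻¹ =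
Σ_n G₀Rⁿ».  Hypotheses: `H_jG_j = 1`, `Σ_j h_j² = 1`, `|h_j| ≤ 1`, the agreement (2.6), supports `S_j ⊇ supp h_j`
carrying the rows of `K_j` with multiplicity `≤ m₀`, and the two per-cube inputs.
[cite: Balaban1983RegularityDecay, (2.12) p.577; (2.9)–(2.11) p.576; Theorem (1.10) p.573] -/
theorem norm_inverse_apply_le [FiniteDimensional ℝ E] (H G : Module.End ℝ (X → E)) (hGH : G * H = 1)
    (Hj Gj : J → Module.End ℝ (X → E)) (hHG : ∀ j, Hj j * Gj j = 1)
    (h : J → X → ℝ) (hsum : ∀ x, ∑ j, h j x ^ 2 = 1) (habs : ∀ j x, |h j x| ≤ 1)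
    (hagree : ∀ j (ψ : X → E), H (h j • ψ) = Hj j (h j • ψ))
    (S : J → Finset X) (hhS : ∀ j x, h j x ≠ 0 → x ∈ S j)
    (hKS : ∀ j (θ : X → E) x, x ∉ S j → (Hj j (h j • θ) - h j • Hj j θ) x = 0)
    (m₀ : ℕ) (hmult : ∀ x, (Finset.univ.filter fun j => x ∈ S j).card ≤ m₀)
    {γ β : ℝ} (hγ : 0 ≤ γ) (hβ : 0 ≤ β)
    (hGj : ∀ j (ψ : X → E), ‖Gj j (h j • ψ)‖ ≤ γ * ‖ψ‖)
    (hKj : ∀ j (ψ : X → E), ‖Hj j (h j • Gj j (h j • ψ)) - h j • Hj j (Gj j (h j • ψ))‖ ≤ β * ‖ψ‖)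
    (hsmall : (m₀ : ℝ) * β ≤ 1 / 2) (φ : X → E) :
    ‖G φ‖ ≤ 2 * m₀ * γ * ‖φ‖ := by
  -- the operator norm of `G`
  set Gc : (X → E) →L[ℝ] (X → E) := LinearMap.toContinuousLinearMap G with hGc_def
  have hGc : ∀ ψ : X → E, G ψ = Gc ψ := fun ψ => rfl
  -- `G = G₀ − G·(Σ_j K_jG_jh_j)` pointwise, hence `‖Gψ‖ ≤ m₀γ‖ψ‖ + ‖Gc‖·m₀β‖ψ‖`
  have key : ∀ ψ : X → E, ‖G ψ‖ ≤ m₀ * γ * ‖ψ‖ + ‖Gc‖ * (m₀ * β * ‖ψ‖) := by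
    intro ψ
    have hpar := parametrix_identity H Hj Gj hHG h hsum hagree ψ
    have hG0 : G (H (∑ j, h j • Gj j (h j • ψ))) = ∑ j, h j • Gj j (h j • ψ) := by
      rw [← Module.End.mul_apply, hGH, Module.End.one_apply]
    rw [hpar, map_add] at hG0
    have hGψ : G ψ = (∑ j, h j • Gj j (h j • ψ))
        - G (∑ j, (Hj j (h j • Gj j (h j • ψ)) - h j • Hj j (Gj j (h j • ψ)))) := by
      rw [← hG0]; abel
    rw [hGψ]
    refine (norm_sub_le _ _).trans (add_le_add ?_ ?_)
    · exact norm_parametrix_le Gj h habs S hhS m₀ hmult hγ hGj ψ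
    · rw [hGc]
      exact (Gc.le_opNorm _).trans
        (mul_le_mul_of_nonneg_left (norm_remainder_le Hj Gj h S hKS m₀ hmult hβ hKj ψ) (norm_nonneg _))
  -- `‖Gc‖ ≤ m₀γ + ‖Gc‖·m₀β ≤ m₀γ + ‖Gc‖/2`
  have hop : ‖Gc‖ ≤ m₀ * γ + ‖Gc‖ * (m₀ * β) := by
    refine ContinuousLinearMap.opNorm_le_bound Gc (by positivity) fun ψ => ?_
    rw [← hGc]
    calc ‖G ψ‖ ≤ m₀ * γ * ‖ψ‖ + ‖Gc‖ * (m₀ * β * ‖ψ‖) := key ψ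
      _ = (m₀ * γ + ‖Gc‖ * (m₀ * β)) * ‖ψ‖ := by ring
  have hhalf : ‖Gc‖ * (m₀ * β) ≤ ‖Gc‖ * (1 / 2) := mul_le_mul_of_nonneg_left hsmall (norm_nonneg _)
  have hM : ‖Gc‖ ≤ 2 * m₀ * γ := by linarith
  calc ‖G φ‖ = ‖Gc φ‖ := by rw [hGc]
    _ ≤ ‖Gc‖ * ‖φ‖ := Gc.le_opNorm φ
    _ ≤ 2 * m₀ * γ * ‖φ‖ := mul_le_mul_of_nonneg_right hM (norm_nonneg _)

/-- **(2.12) for `G = H⁻¹` given as `Ring.inverse H`** (the shape of the Higgs-model propagator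
`HiggsCovariance.propagatorK = Ring.inverse (covOpK …)`): when `H` is a unit, `‖H⁻¹φ‖_∞ ≤ 2m₀γ‖φ‖_∞` under the
hypotheses of `norm_inverse_apply_le`. [cite: Balaban1983RegularityDecay, (2.12) p.577; Theorem (1.10) p.573] -/
theorem norm_inverse_apply_le_of_isUnit [FiniteDimensional ℝ E] (H : Module.End ℝ (X → E)) (hH : IsUnit H)
    (Hj Gj : J → Module.End ℝ (X → E)) (hHG : ∀ j, Hj j * Gj j = 1)
    (h : J → X → ℝ) (hsum : ∀ x, ∑ j, h j x ^ 2 = 1) (habs : ∀ j x, |h j x| ≤ 1)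
    (hagree : ∀ j (ψ : X → E), H (h j • ψ) = Hj j (h j • ψ))
    (S : J → Finset X) (hhS : ∀ j x, h j x ≠ 0 → x ∈ S j)
    (hKS : ∀ j (θ : X → E) x, x ∉ S j → (Hj j (h j • θ) - h j • Hj j θ) x = 0)
    (m₀ : ℕ) (hmult : ∀ x, (Finset.univ.filter fun j => x ∈ S j).card ≤ m₀)
    {γ β : ℝ} (hγ : 0 ≤ γ) (hβ : 0 ≤ β)
    (hGj : ∀ j (ψ : X → E), ‖Gj j (h j • ψ)‖ ≤ γ * ‖ψ‖)
    (hKj : ∀ j (ψ : X → E), ‖Hj j (h j • Gj j (h j • ψ)) - h j • Hj j (Gj j (h j • ψ))‖ ≤ β * ‖ψ‖)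
    (hsmall : (m₀ : ℝ) * β ≤ 1 / 2) (φ : X → E) :
    ‖Ring.inverse H φ‖ ≤ 2 * m₀ * γ * ‖φ‖ :=
  norm_inverse_apply_le H (Ring.inverse H) (Ring.inverse_mul_cancel H hH) Hj Gj hHG h hsum habs hagree S hhS hKS
    m₀ hmult hγ hβ hGj hKj hsmall φ

end Literature.MathematicalPhysics.QuantumFieldTheory.Balaban1983to89.B4Eq212SupNeumann
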